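import Literature.MathematicalPhysics.QuantumFieldTheory.QuasiLocalGaugePerturbationKernels
import Literature.MathematicalPhysics.QuantumFieldTheory.TorusLoopReflection
import Summits.Ventures.YMGap.RobustBall.TermPerturbation
import HarnessLib

/-!
# Venture YMGap, track ROBUST-BALL — loop screening II: the fundamental loop term and the
# tier-2 area-law statement `AreaLawOnBallC`

HONEST FRAMING. WHAT THIS IS: a venture file (cell `pub-ymgap`, track Y2, seat lit-1 g5): the
DEFINITIONS of the tier-2 area-law NO-GO (`RobustBall/AreaLawTierTwoNoGo.lean`) and their algebra.
Strong-coupling / finite-torus lattice objects only; nothing about the continuum.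

* Geometry of the rectangular loop `C = R × T` at `x` in the `(i, j)` plane: its base sites
  `loopSites`, locality `rectangleHolonomy_congr` / `wilsonLoop_congr`, gauge covariance
  `rectangleHolonomy_gaugeTransform` and **gauge invariance of the Wilson loop**
  `isGaugeInvariant_wilsonLoop`, the first-link factorisation `hol = U_{(x,i)} · restHolonomy`
  (`rectangleHolonomy_eq_first_mul`) with `restHolonomy_update` (the rest does not read the first
  link when `i ≠ j`, `R ≤ L`, `1 ≤ T < L`).
* `loopTerm ρ hρ t x i j R T : QuasiLocalGaugePerturbation d L G 1` — **the fundamental loop term**,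
  the one-term perturbation with activity `t · W_C` on the polymer `loopSites` (for `G = SU(N)`,
  `ρ` the fundamental representation, a `RobustBall.Perturbation d L N`); `loopTerm_total`
  (`W = t W_C`), `perturbedMeasure_loopTerm` (`μ_{β, t W_C} = μ_β.tilted(-t W_C)`). Loop terms
  with coefficients `∝ K^{|C|}` are the hopping-parameter expansion of a heavy matter field in the
  representation `ρ` (Montvay–Münster (5.30)–(5.31)).
* `traceObs ρ = (1/N) Re tr ρ`, its Haar variance `haarTraceVariance ρ`, and the one-link action
  bound `linkActionBound d N`.
* `AreaLawOnBallC N d β κ ε₀ ε₁` — the area law UNIFORM ON THE TIER-2 BALL `ClusterDomain κ ε₀ ε₁`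
  under centre-slab invariance of the total perturbation ONLY (no vertical dependence window):
  the verbatim analogue of `AreaLawOnBall` (Defs) with `ClusterDomainFR ε₀ ε₁ r, IsSlabLocal mv`
  replaced by `ClusterDomain κ ε₀ ε₁` + `center_inv`. It is REFUTED in `AreaLawTierTwoNoGo.lean`;
  the name `AreaLawOnBallW … mv` is reserved (rb-theory g3, ROBUST-BALL-STATEMENT.md §6) for the
  twin keeping `IsSlabLocal mv` (vertical window), which no screening member hits.

## References

* I. Montvay, G. Münster, *Quantum Fields on a Lattice* (1994), §5.1.3 (5.30)–(5.31). [MontvayMunster1994]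
* J. Greensite, *An Introduction to the Confinement Problem*, LNP 821 (2011), Ch. 15, eq. (15.11). [Greensite2011]
-/

noncomputable section

open MeasureTheory ProbabilityTheory Real Finset
open Literature.Probability.LatticeModels
open Literature.MathematicalPhysics.QuantumFieldTheory
open Literature.MathematicalPhysics.QuantumLattice (fundamentalRep fundamentalRep_apply
  continuous_fundamentalRep wilsonMeasure_eq_tilted_pi)

namespace Summit.Ventures.YMGap.RobustBall

namespace LoopScreening

/-! ### Geometry of the rectangular loop: its base sites, locality, gauge invariance, first link -/

section Geometry

variable {d L : ℕ} {G : Type*} [Group G]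

/-- The base sites of the links of the rectangular `R × T` loop at `x` in the `(i, j)` plane
(bottom side, right side, top side, left side). [folklore] -/
def loopSites (x : Site d L) (i j : Fin d) (R T : ℕ) : Finset (Site d L) :=
  ((range R).image fun k : ℕ => x + Pi.single i ((k : ℕ) : ZMod L)) ∪
  ((range T).image fun k : ℕ => x + Pi.single i ((R : ℕ) : ZMod L) + Pi.single j ((k : ℕ) : ZMod L)) ∪
  ((range R).image fun k : ℕ => x + Pi.single j ((T : ℕ) : ZMod L) + Pi.single i ((k : ℕ) : ZMod L)) ∪
  ((range T).image fun k : ℕ => x + Pi.single j ((k : ℕ) : ZMod L))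

/-- **Locality of the loop holonomy**: it only reads links based at the loop's sites. [folklore] -/
theorem rectangleHolonomy_congr {U V : GaugeConfig d L G} {x : Site d L} {i j : Fin d} {R T : ℕ}
    (h : ∀ e : Edge d L, e.1 ∈ loopSites x i j R T → U e = V e) :
    rectangleHolonomy U x i j R T = rectangleHolonomy V x i j R T := by
  unfold rectangleHolonomy
  have h1 : lineHolonomy U i R x = lineHolonomy V i R x :=
    lineHolonomy_congr i R x fun s hs => h _ (by
      simp only [loopSites, mem_union, mem_image, mem_range]
      exact Or.inl (Or.inl (Or.inl ⟨s, hs, rfl⟩)))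
  have h2 : lineHolonomy U j T (x + Pi.single i ((R : ℕ) : ZMod L)) =
      lineHolonomy V j T (x + Pi.single i ((R : ℕ) : ZMod L)) :=
    lineHolonomy_congr j T _ fun s hs => h _ (by
      simp only [loopSites, mem_union, mem_image, mem_range]
      exact Or.inl (Or.inl (Or.inr ⟨s, hs, rfl⟩)))
  have h3 : lineHolonomy U i R (x + Pi.single j ((T : ℕ) : ZMod L)) =
      lineHolonomy V i R (x + Pi.single j ((T : ℕ) : ZMod L)) :=
    lineHolonomy_congr i R _ fun s hs => h _ (by
      simp only [loopSites, mem_union, mem_image, mem_range]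
      exact Or.inl (Or.inr ⟨s, hs, rfl⟩))
  have h4 : lineHolonomy U j T x = lineHolonomy V j T x :=
    lineHolonomy_congr j T x fun s hs => h _ (by
      simp only [loopSites, mem_union, mem_image, mem_range]
      exact Or.inr ⟨s, hs, rfl⟩)
  rw [h1, h2, h3, h4]

/-- Gauge covariance of a line holonomy: `P_{U^g}(y → y + n eₖ) = g(y) P_U (g(y + n eₖ))⁻¹`. [folklore] -/
theorem lineHolonomy_gaugeTransform (g : Site d L → G) (U : GaugeConfig d L G) (k : Fin d) :
    ∀ (n : ℕ) (y : Site d L), lineHolonomy (gaugeTransform g U) k n y =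
      g y * lineHolonomy U k n y * (g (y + Pi.single k ((n : ℕ) : ZMod L)))⁻¹
  | 0, y => by simp
  | n + 1, y => by
      rw [lineHolonomy_succ, lineHolonomy_succ, lineHolonomy_gaugeTransform g U k n (y.shift k),
        shift_add_single]
      simp only [gaugeTransform]
      group

/-- Gauge covariance of the rectangular loop holonomy: conjugation by `g` at the base point. [folklore] -/
theorem rectangleHolonomy_gaugeTransform (g : Site d L → G) (U : GaugeConfig d L G) (x : Site d L)
    (i j : Fin d) (R T : ℕ) :
    rectangleHolonomy (gaugeTransform g U) x i j R T = g x * rectangleHolonomy U x i j R T * (g x)⁻¹ := by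
  simp only [rectangleHolonomy, lineHolonomy_gaugeTransform]
  have hc : x + Pi.single j ((T : ℕ) : ZMod L) + Pi.single i ((R : ℕ) : ZMod L) =
      x + Pi.single i ((R : ℕ) : ZMod L) + Pi.single j ((T : ℕ) : ZMod L) := add_right_comm _ _ _
  rw [hc]
  group

variable {N : ℕ} (ρ : G →* Matrix (Fin N) (Fin N) ℂ)

/-- **Gauge invariance of the Wilson loop observable.** [folklore] -/
theorem isGaugeInvariant_wilsonLoop (x : Site d L) (i j : Fin d) (R T : ℕ) :
    IsGaugeInvariant (wilsonLoop ρ x i j R T : GaugeConfig d L G → ℝ) := by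
  intro g U
  simp only [wilsonLoop, rectangleHolonomy_gaugeTransform, map_mul]
  rw [Matrix.trace_mul_cycle, ← map_mul, inv_mul_cancel, map_one, one_mul]

/-- The Wilson loop observable only reads links based at the loop's sites. [folklore] -/
theorem wilsonLoop_congr {U V : GaugeConfig d L G} {x : Site d L} {i j : Fin d} {R T : ℕ}
    (h : ∀ e : Edge d L, e.1 ∈ loopSites x i j R T → U e = V e) :
    wilsonLoop ρ x i j R T U = wilsonLoop ρ x i j R T V := by
  simp only [wilsonLoop, rectangleHolonomy_congr h]

/-- The holonomy of the loop with its FIRST link removed (`R ≥ 1`): the path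
`x + eᵢ → x + R eᵢ → x + R eᵢ + T eⱼ → x + T eⱼ → x`. [folklore] -/
def restHolonomy (U : GaugeConfig d L G) (x : Site d L) (i j : Fin d) (R T : ℕ) : G :=
  lineHolonomy U i (R - 1) (x.shift i) * lineHolonomy U j T (x + Pi.single i ((R : ℕ) : ZMod L)) *
    (lineHolonomy U i R (x + Pi.single j ((T : ℕ) : ZMod L)))⁻¹ * (lineHolonomy U j T x)⁻¹

/-- **First-link factorisation**: `hol = U(x,i) · rest` for `R ≥ 1`. [folklore] -/
theorem rectangleHolonomy_eq_first_mul {R : ℕ} (hR : 1 ≤ R) (U : GaugeConfig d L G) (x : Site d L)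
    (i j : Fin d) (T : ℕ) :
    rectangleHolonomy U x i j R T = U (x, i) * restHolonomy U x i j R T := by
  obtain ⟨R', rfl⟩ : ∃ R', R = R' + 1 := ⟨R - 1, by omega⟩
  simp only [rectangleHolonomy, restHolonomy, lineHolonomy_succ, Nat.add_sub_cancel, mul_assoc]

/-- **The rest of the loop does not read the first link** (`i ≠ j`, `1 ≤ T < L`, `R ≤ L`: the
loop is simple at its first link). [folklore] -/
theorem restHolonomy_update [NeZero L] [DecidableEq (Edge d L)] {x : Site d L} {i j : Fin d}
    (hij : i ≠ j) {R T : ℕ} (hRL : R ≤ L) (hT : 1 ≤ T) (hTL : T < L) (U : GaugeConfig d L G) (g : G) :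
    restHolonomy (Function.update U (x, i) g) x i j R T = restHolonomy U x i j R T := by
  -- a natural number `1 ≤ n < L` is nonzero in `ZMod L`
  have hne : ∀ n : ℕ, 1 ≤ n → n < L → ((n : ℕ) : ZMod L) ≠ 0 := by
    intro n h1 h2 h0
    rw [ZMod.natCast_eq_zero_iff] at h0
    exact absurd (Nat.le_of_dvd (by omega) h0) (by omega)
  unfold restHolonomy
  have h1 : lineHolonomy (Function.update U (x, i) g) i (R - 1) (x.shift i) =
      lineHolonomy U i (R - 1) (x.shift i) :=
    lineHolonomy_congr i (R - 1) _ fun s hs => by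
      rw [Function.update_of_ne]
      intro h
      have h' := congrArg Prod.fst h
      simp only [shift_add_single] at h'
      have : (((s + 1 : ℕ) : ℕ) : ZMod L) = 0 := by
        have := congrFun h' i
        simpa using this
      exact hne (s + 1) (by omega) (by omega) this
  have h2 : lineHolonomy (Function.update U (x, i) g) j T (x + Pi.single i ((R : ℕ) : ZMod L)) =
      lineHolonomy U j T (x + Pi.single i ((R : ℕ) : ZMod L)) :=
    lineHolonomy_congr j T _ fun s hs => by
      rw [Function.update_of_ne]
      intro h
      exact hij (congrArg Prod.snd h).symm
  have h3 : lineHolonomy (Function.update U (x, i) g) i R (x + Pi.single j ((T : ℕ) : ZMod L)) =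
      lineHolonomy U i R (x + Pi.single j ((T : ℕ) : ZMod L)) :=
    lineHolonomy_congr i R _ fun s hs => by
      rw [Function.update_of_ne]
      intro h
      have h' := congrFun (congrArg Prod.fst h) j
      simp only [Pi.add_apply, Pi.single_eq_same, Pi.single_eq_of_ne hij.symm, add_zero,
        add_eq_left] at h'
      exact hne T hT hTL h'
  have h4 : lineHolonomy (Function.update U (x, i) g) j T x = lineHolonomy U j T x :=
    lineHolonomy_congr j T _ fun s hs => by
      rw [Function.update_of_ne]
      intro h
      exact hij (congrArg Prod.snd h).symm
  rw [h1, h2, h3, h4]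

end Geometry


/-! ### Part D — the loop-term member of the class of quasi-local gauge-invariant perturbations -/

section MemberDefs

variable {d L : ℕ} {G : Type*} [Group G] [TopologicalSpace G] [IsTopologicalGroup G]
  {N : ℕ} (ρ : G →* Matrix (Fin N) (Fin N) ℂ)

/-- Line holonomies are continuous in the configuration. [folklore] -/
theorem continuous_lineHolonomy (k : Fin d) :
    ∀ (n : ℕ) (y : Site d L), Continuous fun U : GaugeConfig d L G => lineHolonomy U k n y
  | 0, _ => by simpa using continuous_const
  | n + 1, y => by
      simp only [lineHolonomy_succ]
      exact (continuous_apply _).mul (continuous_lineHolonomy k n _)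

/-- The rectangular loop holonomy is continuous in the configuration. [folklore] -/
theorem continuous_rectangleHolonomy (x : Site d L) (i j : Fin d) (R T : ℕ) :
    Continuous fun U : GaugeConfig d L G => rectangleHolonomy U x i j R T := by
  unfold rectangleHolonomy
  exact (((continuous_lineHolonomy i R x).mul (continuous_lineHolonomy j T _)).mul
    (continuous_lineHolonomy i R _).inv).mul (continuous_lineHolonomy j T x).inv

/-- The Wilson loop observable is continuous (continuous `ρ`). [folklore] -/
theorem continuous_wilsonLoop (hρ : Continuous ρ) (x : Site d L) (i j : Fin d) (R T : ℕ) :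
    Continuous (wilsonLoop ρ x i j R T : GaugeConfig d L G → ℝ) := by
  unfold wilsonLoop
  exact continuous_const.mul ((continuous_trace_re ρ hρ).comp (continuous_rectangleHolonomy x i j R T))

omit [TopologicalSpace G] [IsTopologicalGroup G] in
/-- `|W_C| ≤ 1` when `|Re tr ρ| ≤ N` (e.g. `ρ` unitary). [folklore] -/
theorem abs_wilsonLoop_le_one (hM : ∀ g, |(ρ g).trace.re| ≤ N) (x : Site d L) (i j : Fin d) (R T : ℕ)
    (U : GaugeConfig d L G) : |wilsonLoop ρ x i j R T U| ≤ 1 := by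
  unfold wilsonLoop
  rw [abs_mul, abs_inv, Nat.abs_cast]
  rcases Nat.eq_zero_or_pos N with hN | hN
  · subst hN; simp
  · have hN' : (0 : ℝ) < N := by exact_mod_cast hN
    rw [inv_mul_le_iff₀ hN', mul_one]
    exact hM _

end MemberDefs

section Member

variable {d L : ℕ} [NeZero L] {G : Type*} [Group G] [TopologicalSpace G] [IsTopologicalGroup G]
  [CompactSpace G] [MeasurableSpace G] [BorelSpace G] [SecondCountableTopology G] {N : ℕ}
  (ρ : G →* Matrix (Fin N) (Fin N) ℂ)

/-- **The fundamental loop term.** The one-term perturbation of the Wilson action whose only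
activity is `t · W_C`, `W_C = (1/N) Re tr ρ(U_C)` the Wilson loop of the rectangle `C = R × T` at
`x` in the `(i, j)` plane, carried by the polymer of the base sites of `C`'s links (block scale `1`).
Such loop terms with coefficients `∝ K^{|C|}` are exactly the terms of the hopping-parameter
expansion of the effective gauge action of a heavy matter field in the representation `ρ`,
`S_eff = -Tr log(1 - K M[U]) = ∑_l (K^l / l) ∑_{|C| = l} tr_c U_C · (spin trace)`
(Montvay–Münster (5.30)–(5.31)). [cite: MontvayMunster1994, §5.1.3 (5.30)–(5.31)] -/
def loopTerm (hρ : Continuous ρ) (t : ℝ) (x : Site d L) (i j : Fin d) (R T : ℕ) :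
    QuasiLocalGaugePerturbation d L G 1 where
  act X U := if X = loopSites x i j R T then t * wilsonLoop ρ x i j R T U else 0
  dependsOn' X := by
    intro U V hUV
    by_cases hX : X = loopSites x i j R T
    · subst hX
      simp only [if_true]
      rw [wilsonLoop_congr ρ (U := U) (V := V) fun e he => hUV e (by
        rw [Finset.mem_coe, mem_polymerEdges_iff, blockCorner_one]; exact he)]
    · simp [hX]
  gaugeInvariant' X := by
    intro g U
    by_cases hX : X = loopSites x i j R T
    · simp only [hX, if_true, isGaugeInvariant_wilsonLoop ρ x i j R T g U]
    · simp [hX]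
  measurable' X := by
    by_cases hX : X = loopSites x i j R T
    · simp only [hX, if_true]
      exact ((continuous_wilsonLoop ρ hρ x i j R T).measurable).const_mul t
    · simp only [hX, if_false]; exact measurable_const
  bounded' X := by
    obtain ⟨M, -, hM⟩ := exists_bound_trace_re_nonneg ρ hρ
    refine ⟨|t| * ((N : ℝ)⁻¹ * M), fun U => ?_⟩
    by_cases hX : X = loopSites x i j R T
    · simp only [hX, if_true, abs_mul]
      refine mul_le_mul_of_nonneg_left ?_ (abs_nonneg t)
      unfold wilsonLoop
      rw [abs_mul, abs_inv, Nat.abs_cast]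
      exact mul_le_mul_of_nonneg_left (hM _) (by positivity)
    · simp only [hX, if_false, abs_zero]
      exact mul_nonneg (abs_nonneg t) (mul_nonneg (by positivity)
        ((abs_nonneg _).trans (hM (Classical.arbitrary G))))

variable {ρ}

/-- The activities of the loop term. [folklore] -/
@[simp] theorem loopTerm_act (hρ : Continuous ρ) (t : ℝ) (x : Site d L) (i j : Fin d) (R T : ℕ)
    (X : Finset (Site d L)) (U : GaugeConfig d L G) :
    (loopTerm ρ hρ t x i j R T).act X U =
      if X = loopSites x i j R T then t * wilsonLoop ρ x i j R T U else 0 := rfl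

/-- The total of the loop term is `t · W_C`. [folklore] -/
theorem loopTerm_total (hρ : Continuous ρ) (t : ℝ) (x : Site d L) (i j : Fin d) (R T : ℕ)
    (U : GaugeConfig d L G) :
    (loopTerm ρ hρ t x i j R T).total U = t * wilsonLoop ρ x i j R T U := by
  simp only [QuasiLocalGaugePerturbation.total, loopTerm_act, Finset.sum_ite_eq',
    if_pos (mem_polymers_one (loopSites x i j R T))]

/-- Negating the coefficient negates the loop term. [folklore] -/
theorem loopTerm_neg (hρ : Continuous ρ) (t : ℝ) (x : Site d L) (i j : Fin d) (R T : ℕ) :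
    loopTerm ρ hρ (-t) x i j R T = -loopTerm ρ hρ t x i j R T := by
  ext X U
  simp only [loopTerm_act, QuasiLocalGaugePerturbation.neg_act]
  split_ifs <;> simp [neg_mul]

/-- **The loop-term theory is the Wilson theory tilted by the loop**:
`μ_{β, t W_C} = μ_{β}.tilted(-t W_C)` (weights `e^{-β S - W}`). [folklore] -/
theorem perturbedMeasure_loopTerm (hρ : Continuous ρ) (β t : ℝ) (x : Site d L) (i j : Fin d)
    (R T : ℕ) :
    (loopTerm ρ hρ t x i j R T).perturbedMeasure ρ β =
      (wilsonMeasure ρ β).tilted fun U => -(t * wilsonLoop ρ x i j R T U) := by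
  rw [QuasiLocalGaugePerturbation.perturbedMeasure_eq_tilted ρ hρ, wilsonMeasure_eq_tilted_pi ρ hρ β,
    tilted_tilted]
  · congr 1
    funext U
    rw [Pi.add_apply, loopTerm_total]
    ring
  · exact integrable_exp_of_abs_le _ ((measurable_wilsonAction ρ hρ).const_mul _) (by
      obtain ⟨B, hB⟩ := exists_abs_wilsonAction_le (d := d) (L := L) ρ hρ
      refine ⟨|β| * B, fun U => ?_⟩
      rw [abs_mul, abs_neg]
      exact mul_le_mul_of_nonneg_left (hB U) (abs_nonneg _))

end Member



/-! ### The trace observable, its Haar variance, the one-link action bound -/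

section Trace

variable {G : Type*} [Group G] [TopologicalSpace G] [IsTopologicalGroup G] [CompactSpace G]
  [MeasurableSpace G] [BorelSpace G] {N : ℕ} (ρ : G →* Matrix (Fin N) (Fin N) ℂ)

/-- The normalised trace observable `g ↦ (1/N) Re tr ρ(g)` on the group. [folklore] -/
def traceObs (g : G) : ℝ := (N : ℝ)⁻¹ * (ρ g).trace.re

/-- **The Haar variance of the normalised trace**, `v_ρ = ∫ (f - ∫ f)² dHaar`, `f = (1/N) Re tr ρ`
(for `SU(2)`: `1/4`; for `SU(N)`, `N ≥ 3`: `1/(2N²)`, by Schur orthogonality — not used). [folklore] -/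
def haarTraceVariance : ℝ :=
  ∫ g, (traceObs ρ g - ∫ g', traceObs ρ g' ∂haarProbability G) ^ 2 ∂haarProbability G

/-- A volume-independent bound on the change of the Wilson action under a change of ONE link
(`|Re tr ρ| ≤ N`): `2 (d+1) · #planes · 2N` (crude; the sharp value is `4(d-1)N`). [folklore] -/
def linkActionBound (d N : ℕ) : ℝ :=
  2 * (((d + 1) * Fintype.card {q : Fin d × Fin d // q.1 < q.2} : ℕ) : ℝ) * ((N : ℝ) + N)

variable {ρ}

omit [CompactSpace G] [MeasurableSpace G] [BorelSpace G] [TopologicalSpace G]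
  [IsTopologicalGroup G] in
/-- The trace observable is bounded by `1` when `|Re tr ρ| ≤ N`. [folklore] -/
theorem abs_traceObs_le_one (hM : ∀ g, |(ρ g).trace.re| ≤ N) (g : G) : |traceObs ρ g| ≤ 1 := by
  unfold traceObs
  rw [abs_mul, abs_inv, Nat.abs_cast]
  rcases Nat.eq_zero_or_pos N with hN | hN
  · subst hN; simp
  · have hN' : (0 : ℝ) < N := by exact_mod_cast hN
    rw [inv_mul_le_iff₀ hN', mul_one]
    exact hM _

omit [CompactSpace G] [MeasurableSpace G] [BorelSpace G] [IsTopologicalGroup G] in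
/-- The trace observable is continuous. [folklore] -/
theorem continuous_traceObs (hρ : Continuous ρ) : Continuous (traceObs ρ) :=
  continuous_const.mul (continuous_trace_re ρ hρ)


end Trace



end LoopScreening

/-! ### The tier-2 area-law statement under centre-slab invariance only -/

section AreaLawC

/-- **Area law uniform on the tier-2 ball, centre-invariance only** (`AreaLawOnBallC`): constants
`C, c > 0` such that for every torus `L`, every member `W` of the TIER-2 ball `ClusterDomain κ ε₀ ε₁`
(loads weighted by `e^{κ · diam X}`, no range cut-off) whose total perturbation is invariant under
every centre rotation of one slab of vertical links, and every rectangular `R × T` Wilson loop,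
`|⟨W_{R×T}⟩_{β,W,L}| ≤ C^{2(R+T)} e^{-c R T}` — `AreaLawOnBall` (Defs) with `ClusterDomainFR ε₀ ε₁ r`,
`IsSlabLocal mv` replaced by `ClusterDomain κ ε₀ ε₁` and `center_inv` ALONE (NO vertical dependence
window). REFUTED for all `N ≥ 2, d ≥ 2, β, κ, ε₀ > 0, ε₁ > 0` in `AreaLawTierTwoNoGo.lean`; the
honest tier-2 area law keeps the vertical window (`AreaLawOnBallW … mv`, rb-theory, reserved name). [folklore] -/
def AreaLawOnBallC (N d : ℕ) (β κ ε₀ ε₁ : ℝ) : Prop :=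
  ∃ C c : ℝ, 0 < c ∧ ∀ (L : ℕ) [NeZero L] (W : Perturbation d L N), W ∈ ClusterDomain κ ε₀ ε₁ →
    (∀ (v : Fin d) (t : ZMod L) (z : SUN N), z ∈ Subgroup.center (SUN N) →
      ∀ U, W.total (centerSlabRotate v t z U) = W.total U) →
    ∀ (x : Site d L) (i j : Fin d) (R T : ℕ), i ≠ j → 1 ≤ R → 1 ≤ T → 2 * R ≤ L → 2 * T ≤ L →
      |W.expectation (fundamentalRep (Fin N)) β (wilsonLoop (fundamentalRep (Fin N)) x i j R T)| ≤
        C ^ (2 * (R + T)) * Real.exp (-c * (R * T))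

end AreaLawC

end Summit.Ventures.YMGap.RobustBall
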